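import Mathlib.LinearAlgebra.Matrix.Determinant.Basic
import Mathlib.MeasureTheory.Integral.IntervalIntegral.Basic
import Mathlib.MeasureTheory.Function.LpSeminorm.Basic
import Literature.NumberTheory.LFunctions.ZetaScrew
import Literature.NumberTheory.LFunctions.LiCriterion
import Literature.NumberTheory.LFunctions.RiemannXiLogDeriv
import Literature.NumberTheory.LFunctions.ZetaScrewHermitianForms
import HarnessLib

/-!
# Suzuki's screw function `Ψ`: boundedness criterion, non-integrability, Hankel moments,
# relations with the Li coefficients, the null series, and the shifted variants `Ψ_ω`

LINE 1 — LABEL: RH-FREE corpus literature (typed statements of Suzuki2023 = M. Suzuki,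
*Aspects of the screw function corresponding to the Riemann zeta-function*, J. Lond. Math. Soc.
(2) 108 (2023) 1448–1487 = arXiv:2206.03682, §§1, 6, 7, 8, 11, the parts NOT already in
`Literature/NumberTheory/LFunctions/ZetaScrew.lean`); the RH-EQUIVALENT statements (Thms 1.6,
1.8; Thm 11.1 at `ω = 0`) say so on line 1 of their docstrings, with the status of each
direction; RH-CONSEQUENCE clauses carry the explicit binder. bears_on: LADDER-RH B-C/B-P
(COLUMN 6, de Branges–Suzuki corpus; the object `Ψ` itself is COLUMN 1's `zetaScrew`).
WHAT THIS IS NOT: not a route and not progress toward RH — formalising a criterion's corpus fixes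
WHICH inequality would prove RH (here: `Ψ = O(1)`, resp. the Hankel determinant signs, resp. the
eventual sign of `Ψ_ω`), it does not move RH; nothing here bears on the truth of RH.

All objects are the tree's: `Ψ = zetaScrew` (Suzuki2023 (1.1), `ZetaScrew.lean`, with the named
facts `Suzuki2023_thm11_fourier/_series/_growth`, `Suzuki2023_thm12`, `Suzuki2023_thm17`, all
discharged in the sibling proofs files), `ξ = riemannXi`, the non-trivial zeros
`ZetaZeros.riemannZetaNontrivialZeros` with multiplicities `riemannZetaZeroOrder`, the Li
coefficients `λ_n = keiperLiCoeff n` and Li's `φ(w) = ξ(1/(1-w)) = liPhi w` (`LiCriterion.lean`).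
Dictionary `γ ↔ ρ` as in `ZetaScrew.lean`: Suzuki's zeros `γ` of `ξ(1/2 - iz)` (with
multiplicity) correspond to `ρ = 1/2 - iγ`, `γ = i(ρ - 1/2)`, so `e^{iγt} = e^{-(ρ-1/2)t}`,
`γ² = -(ρ - 1/2)²`.

## Contents (source item → declaration; "fact" = `def … : Prop`, to be discharged in the sibling
## `ZetaScrewGrowthMomentsProofs.lean`)

* Thm 1.6 (`RH ⟺ Ψ = O(1)` on `[0,∞)`) → `Suzuki2023_thm16` (fact; both directions are short over
  the tree: `⟹` by Thm 1.1 (2), `|Ψ(t)| ≤ 2∑_γ γ^{-2}` under RH; `⟸` because a bounded `Ψ` has a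
  Laplace transform holomorphic on `ℂ₊`, cf. the proof of `Suzuki2023_thm17_holds`).
* Remark after Thm 1.6, p. 3 ("`Ψ(t)` belongs to neither `L¹(0,∞)` nor `L²(0,∞)`, regardless of
  whether the RH is true or false") → `Suzuki2023_zetaScrew_notMemLp` (fact, RH-FREE).
* (1.13) the moments `μ_n = ∫₀^∞ 4^{-1} e^{-t/2} Ψ(t) tⁿ dt` → `zetaScrewMoment n`; the Hankel
  matrices `Δ_n = (μ_{i+j})_{0≤i,j≤n}`, `Δ_n^{(1)} = (μ_{i+j+1})` → `zetaScrewHankel n`,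
  `zetaScrewHankelShift n`; Thm 1.8 (`RH ⟺ det Δ_n ≥ 0 ∧ det Δ_n^{(1)} ≥ 0 ∀ n ≥ 1`) →
  `Suzuki2023_thm18` (fact).
* Thm 6.1 (RH false ⟹ a non-trivial null series `∑_γ w_γ (e^{iγt} - 1)/γ² = 0` on an interval)
  → `Suzuki2023_thm61` (fact; consequence of Thm 1.4, not in the tree).
* Thm 8.1 (the Li coefficients in terms of the moments, (8.1)–(8.2), and conversely (8.3)) →
  `Suzuki2023_thm81`, `Suzuki2023_thm81_inv` (facts, RH-FREE identities), with the arithmetic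
  check `Suzuki2023_thm81_cases` (proved) that (8.2) at `n = 1, 2, 3` is (8.1).
* Thm 8.2 (the recurrence (8.9) for `μ_n` with positive coefficients `b_{n,k}` built from the
  Taylor coefficients `a_j` of `ξ(1/(1-w))/ξ(1)`) → `liXiCoeff j` (`a_j`), `suzukiB n k`
  (`b_{n,k}`), `Suzuki2023_thm82` (fact, RH-FREE).
* §11: (11.1) the shifted screw functions `Ψ_ω` → `zetaScrewShift ω t` (`Ψ_0 = Ψ`:
  `zetaScrewShift_zero_left`, proved); (11.2) their one-sided Fourier transform →
  `Suzuki2023_eq112` (fact, RH-FREE, with the half-plane of convergence made precise, see its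
  docstring); Thm 11.1 (`ξ ≠ 0` on `Re s > 1/2 + ω` ⟺ `Ψ_ω ≥ 0` eventually) → `Suzuki2023_thm111`
  (fact; a graded family: RH-EQUIVALENT at `ω = 0`, an RH-FREE theorem of the tree's
  `riemannXi_ne_zero_of_one_le_re` at `ω ≥ 1/2`, cf. `Suzuki2023_thm111.eventually_nonneg`).
* §4.2/§4.4: Yoshida's spaces `K(a)`, `K_N(a)` ((4.1), after [Yo92]) → `yoshidaK a`, `yoshidaKN a N`;
  the transform `Φ₁(φ,z)` (4.2) → `screwPhi1 a φ z`; the space `𝔎_{N,0}(a)` → `screwKN0 a N`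
  (over `screwPrimitive` = `I_0^{(a)}` of `ZetaScrewHermitianForms.lean`); Thm 4.3 (Yoshida-type
  lower bound `⟨φ,φ⟩_{G_g,a} ≥ μ∫|Φ₁(φ,z)|²dz` on `𝔎_{N,0}(a)`, uniformly in `0 < a ≤ a₀`, used in
  the proof of Thm 1.4) → `Suzuki2023_thm43` (fact, RH-FREE; form = `zetaScrewForm (Ioo (-a) a)`).

## Deliberately NOT here

* Thms 1.3, 1.4, 1.5, Prop. 2.1, Prop. 3.1 (the hermitian forms `⟨·,·⟩_{G_g,a}`, the operator
  `G_g[a]`, trace class) — the sibling module `ZetaScrewHermitianForms.lean` of this corpus wave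
  (imported here for Thm 4.3 only).
* The conditional evaluation `limsup Ψ = 2∑γ^{-2}`, `liminf Ψ = 0` of §7.1 (assumes RH, simple
  zeros and the linear independence of the ordinates) — a remark, not a theorem of the source.
* §9 (Kotani's zeta string), §10 (mean-periodicity), §12 (Hilbert–Pólya space) — other topics.

## References

* M. Suzuki, *Aspects of the screw function corresponding to the Riemann zeta-function*,
  J. Lond. Math. Soc. (2) 108 (2023), no. 4, 1448–1487; arXiv:2206.03682. [Suzuki2023]
  Locators below are to the arXiv text (`lit read paper:arxiv-2206.03682`, pages `pNNNN:Lnn`).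
* X.-J. Li, *The positivity of a sequence of numbers and the Riemann hypothesis*, J. Number
  Theory 65 (1997) 325–333 (the coefficients `a_j` and the recurrence (8.10)). [Li1997]
* M. G. Kreĭn, A. A. Nudel'man, *The Markov moment problem and extremal problems*, AMS (1977)
  (Stieltjes moment sequences and Hankel determinants, used in Thm 1.8). [KreinNudelman1977]
* H. Yoshida, *On Hermitian forms attached to zeta functions*, in: Zeta functions in geometry
  (Tokyo, 1990), Adv. Stud. Pure Math. 21 (1992) 281–325 (the spaces `K(a)`, `K_N(a)`). [Yoshida1992]
-/

noncomputable section

open scoped Topology BigOperators Nat ComplexOrder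
open Complex MeasureTheory Set

namespace Literature.NumberTheory.LFunctions

/-! ## Thm 1.6: RH iff `Ψ` is bounded on `[0, ∞)` -/

/-- RH-EQUIVALENT (line 1; both directions dischargeable over the tree, see below).
**Suzuki2023 Thm 1.6**: "The RH is true if and only if `Ψ(t) = O(1)` on `[0, ∞)`", i.e. iff
`∃ M, |Ψ(t)| ≤ M` for all `t ≥ 0` (the paper's convention for `O(·)`, p. 2: "there exists a
positive constant `M` such that `|f(x)| ≤ M g(x)` holds for prescribed range of `x`"; `Ψ` is even,
so this is boundedness on `ℝ`). Printed proof (§7.1, p0017): `⟹` under RH all `γ` are real and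
`|Ψ(t)| ≤ 2∑_γ |γ|^{-2} < ∞` by Thm 1.1 (2) (`Suzuki2023_thm11_series`); `⟸` if `Ψ` is bounded the
integral in Thm 1.1 (1) (`Suzuki2023_thm11_fourier`) converges absolutely and locally uniformly on
`ℂ₊`, so `(ξ'/ξ)(1/2 - iz)` has no poles in `ℂ₊`. Status: RH-CONSEQUENCE direction and RH-FREE
door direction are both short over `ZetaScrewThm17Proofs.lean`'s machinery (discharge target of
the sibling proofs file). Not the tree's `Suzuki2023_thm11_growth` (the unconditional bound
`Ψ ≪ e^{t/2 - c√t}`) nor `Suzuki2023_thm17` (the sign condition `Ψ ≥ 0`).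
[cite: Suzuki2023, Thm 1.6, p. 3 (arXiv p0003:L132); proof §7.1 (p0017:L3–12)] -/
def Suzuki2023_thm16 : Prop :=
  RiemannHypothesis ↔ ∃ M : ℝ, ∀ t : ℝ, 0 ≤ t → |zetaScrew t| ≤ M

/-! ## `Ψ ∉ L¹(0,∞)`, `Ψ ∉ L²(0,∞)` (unconditionally) -/

/-- RH-FREE. **Suzuki2023, remark after Thm 1.6** (p. 3): "`Ψ(t)` belongs to neither `L¹(0,∞)`
nor `L²(0,∞)`, regardless of whether the RH is true or false." Printed argument: if `Ψ ∈ L¹` or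
`L²`, formula (1.2) (`Suzuki2023_thm11_fourier`) holds for `Im z > 0` and defines an analytic
function in `ℂ₊` whose extension to `Im z = 0` is bounded, resp. in `L²(ℝ)`, contradicting the
simple pole of the right-hand side `-z^{-2}(ξ'/ξ)(1/2 - iz)` at `z = 0` (a simple pole because
`ξ'(1/2) = 0` and `ξ''(1/2) ≠ 0`, the latter by the tree's
`iteratedDeriv_two_mul_riemannXi_half_pos`). Typed with Mathlib's `IntegrableOn` (= membership in
`L¹` for the continuous `Ψ`) and `MemLp · 2` w.r.t. Lebesgue measure restricted to `(0, ∞)`.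
[cite: Suzuki2023, p. 3, remark after Thm 1.6 (arXiv p0003:L140–150)] -/
def Suzuki2023_zetaScrew_notMemLp : Prop :=
  ¬ IntegrableOn zetaScrew (Ioi 0) ∧ ¬ MemLp zetaScrew 2 (volume.restrict (Ioi (0 : ℝ)))

/-! ## (1.13) the moments `μ_n` and Thm 1.8 (Hankel determinants) -/

/-- The `n`-th **moment** of Suzuki2023 (1.13):
`μ_n := ∫₀^∞ 4^{-1} e^{-t/2} Ψ(t) · tⁿ dt` (`n ∈ ℤ_{≥0}`), "where the integral is absolutely
convergent by Theorem 1.1 (3)" (`Suzuki2023_thm11_growth`: the integrand is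
`≪ tⁿ e^{-c√t}`; integrability is proved in the sibling proofs file, here the value is the Bochner
integral over `(0, ∞)`). Under RH `{μ_n}` is the Stieltjes moment sequence of the positive measure
`4^{-1}e^{-t/2}Ψ(t) dt` (§7.3). Also (1.15): `μ_n = dⁿ/dXⁿ[(1-2X)^{-2}(ξ'/ξ)(1-X)]_{X=0}`.
[cite: Suzuki2023, (1.13), p. 3 (arXiv p0003:L155–162)] -/
def zetaScrewMoment (n : ℕ) : ℝ :=
  ∫ t in Ioi (0 : ℝ), 4⁻¹ * Real.exp (-(t / 2)) * zetaScrew t * t ^ n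

/-- The **Hankel matrix** `Δ_n = (μ_{i+j})_{0 ≤ i, j ≤ n}` of the moments (1.13)
(an `(n+1) × (n+1)` real symmetric matrix). [cite: Suzuki2023, Thm 1.8 (definition of `Δ_n`), pp. 3–4 (arXiv p0003:L164–p0004:L18)] -/
def zetaScrewHankel (n : ℕ) : Matrix (Fin (n + 1)) (Fin (n + 1)) ℝ :=
  Matrix.of fun i j ↦ zetaScrewMoment ((i : ℕ) + (j : ℕ))

/-- The **shifted Hankel matrix** `Δ_n^{(1)} = (μ_{i+j+1})_{0 ≤ i, j ≤ n}` of the moments (1.13).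
[cite: Suzuki2023, Thm 1.8 (definition of `Δ_n^{(1)}`), p. 4 (arXiv p0004:L1–18)] -/
def zetaScrewHankelShift (n : ℕ) : Matrix (Fin (n + 1)) (Fin (n + 1)) ℝ :=
  Matrix.of fun i j ↦ zetaScrewMoment ((i : ℕ) + (j : ℕ) + 1)

/-- Unfolding lemma for the entries of `Δ_n`. [cite: Suzuki2023, Thm 1.8] -/
theorem zetaScrewHankel_apply (n : ℕ) (i j : Fin (n + 1)) :
    zetaScrewHankel n i j = zetaScrewMoment ((i : ℕ) + (j : ℕ)) := rfl

/-- Unfolding lemma for the entries of `Δ_n^{(1)}`. [cite: Suzuki2023, Thm 1.8] -/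
theorem zetaScrewHankelShift_apply (n : ℕ) (i j : Fin (n + 1)) :
    zetaScrewHankelShift n i j = zetaScrewMoment ((i : ℕ) + (j : ℕ) + 1) := rfl

/-- `Δ_n` is symmetric (a Hankel matrix). [cite: Suzuki2023, Thm 1.8 (Hankel matrices `Δ_n`)] -/
theorem zetaScrewHankel_transpose (n : ℕ) : (zetaScrewHankel n).transpose = zetaScrewHankel n := by
  ext i j
  simp [zetaScrewHankel, Matrix.transpose_apply, add_comm]

/-- `Δ_n^{(1)}` is symmetric (a Hankel matrix). [cite: Suzuki2023, Thm 1.8 (Hankel matrices `Δ_n^{(1)}`)] -/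
theorem zetaScrewHankelShift_transpose (n : ℕ) :
    (zetaScrewHankelShift n).transpose = zetaScrewHankelShift n := by
  ext i j
  simp [zetaScrewHankelShift, Matrix.transpose_apply, add_comm]

/-- RH-EQUIVALENT (line 1; `⟹` is an RH-CONSEQUENCE via Thm 1.7 and the positivity of Hankel
forms of a Stieltjes moment sequence; `⟸` needs the determinacy of the Stieltjes moment problem
for `{μ_n}` [Lin17] — neither direction is in the tree). **Suzuki2023 Thm 1.8**: with the Hankel
matrices `Δ_n = (μ_{i+j})_{i,j=0}^{n}` and `Δ_n^{(1)} = (μ_{i+j+1})_{i,j=0}^{n}` of the moments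
(1.13), "the RH is true if and only if `det Δ_n ≥ 0` and `det Δ_n^{(1)} ≥ 0` for all
`n ∈ ℤ_{>0}`." (Proof §7.3: under RH `Ψ > 0` on `(0,∞)` (Thm 1.7), so `{μ_n}` is a Stieltjes
moment sequence [KrNu77]; conversely the sign conditions make `{μ_n}` a Stieltjes moment sequence
of some measure on `[0,∞)`, which by the bound `4^{-1}e^{-t/2}Ψ(t) ≪ e^{-c√t}` (Prop. 2.1) and
[Lin17] is determinate, hence equals `4^{-1}e^{-t/2}Ψ(t)dt`, so `Ψ ≥ 0` and RH by Thm 1.7.)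
[cite: Suzuki2023, Thm 1.8, pp. 3–4 (arXiv p0003:L164–p0004:L18); proof §7.3 (p0017:L50–66)] -/
def Suzuki2023_thm18 : Prop :=
  RiemannHypothesis ↔
    ∀ n : ℕ, 1 ≤ n → 0 ≤ (zetaScrewHankel n).det ∧ 0 ≤ (zetaScrewHankelShift n).det

/-! ## Thm 6.1: a non-trivial null series when RH fails -/

/-- RH-FREE as an implication (hypothesis "RH is false"; a consequence of Thm 1.4, which is not
in the tree). **Suzuki2023 Thm 6.1**: "Suppose that the RH is false. Then there exists `a₀ > 0`
and a non-identically vanishing sequence of complex numbers `{w_γ}_γ` such that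
`∑_γ w_γ (e^{iγt} - 1)/γ² = 0` on the interval `(-a₀, a₀)` as a function of `t`" (the sum over
the zeros `γ` of `ξ(1/2 - iz)`; in the proof `w_γ = φ̂(-γ) - φ̂(0)` for an eigenfunction `φ` of
`G_g[a₀]` with eigenvalue `0`, and the series converges absolutely). In the tree's variable
`ρ = 1/2 - iγ` (module docstring) the summand is `w(ρ)(1 - e^{-(ρ-1/2)t})/(ρ-1/2)²`. Indexing:
the source lets `γ` run "counting with multiplicity", but its weights depend only on `γ`, so the
copies of a multiple zero carry equal weights and merge into one term `m(ρ)w(ρ)(…)`; since the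
`w`'s are free, the factor `m(ρ) ≥ 1` is immaterial for this existence statement and we index by
the distinct zeros (the reading under which the statement is not trivialised by a multiple zero).
Convergence is typed as `HasSum` (unconditional, as for the absolutely convergent series of the
proof). [cite: Suzuki2023, Thm 6.1, p. 16 (arXiv p0016:L159–169)] -/
def Suzuki2023_thm61 : Prop :=
  ¬ RiemannHypothesis →
    ∃ a₀ : ℝ, 0 < a₀ ∧ ∃ w : ZetaZeros.riemannZetaNontrivialZeros → ℂ, w ≠ 0 ∧
      ∀ t : ℝ, t ∈ Ioo (-a₀) a₀ →
        HasSum (fun ρ : ZetaZeros.riemannZetaNontrivialZeros ↦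
          w ρ * ((1 - cexp (-((ρ : ℂ) - 1 / 2) * t)) / ((ρ : ℂ) - 1 / 2) ^ 2)) 0

/-! ## Thm 8.1: the Li coefficients and the moments -/

/-- The right-hand side of Suzuki2023 (8.2) (as a function of `n` and of a moment sequence `μ`):
`∑_{k=0}^{n-1} [k!(k+3)!(n-k-1)!]^{-1} ((k - (4n-1)/2)² + 2n + 7/4) (-1)^k μ_k`.
[cite: Suzuki2023, (8.2), p. 18 (arXiv p0018:L15–22)] -/
def suzukiLiOfMoments (μ : ℕ → ℝ) (n : ℕ) : ℝ :=
  ∑ k ∈ Finset.range n,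
    1 / ((k ! : ℝ) * ((k + 3)! : ℝ) * ((n - k - 1)! : ℝ)) *
      (((k : ℝ) - (4 * n - 1) / 2) ^ 2 + 2 * n + 7 / 4) * (-1) ^ k * μ k

/-- RH-FREE. **Suzuki2023 Thm 8.1, (8.1)–(8.2)**: the Li coefficients
`λ_{n+1} = (1/n!) dⁿ/dwⁿ[(1-w)^{-2}(ξ'/ξ)(1/(1-w))]_{w=0}` ((1.14); these are the tree's
`keiperLiCoeff`, cf. `keiperLiCoeff_eq_iteratedDeriv_log_liPhi`: `∑ λ_{n+1}wⁿ = (log φ)'(w)`,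
`φ(w) = ξ(1/(1-w))`) "are represented by the moments (1.13) as `λ₁ = μ₀`, `λ₂ = 6μ₀ - μ₁`,
`λ₃ = 19μ₀ - 7μ₁ + μ₂/2` (8.1) and
`(1/n!) λ_n = ∑_{k=0}^{n-1} [k!(k+3)!(n-k-1)!]^{-1}((k - (4n-1)/2)² + 2n + 7/4)(-1)^k μ_k` (8.2)
for `n ≥ 4`." Formula (8.2) at `n = 1, 2, 3` IS (8.1) (`Suzuki2023_thm81_cases`, an arithmetic
check proved below), so the printed statement is exactly: (8.2) for all `n ≥ 1`, as typed.
(Proof §8: both sides are read off from the two expansions (8.4)–(8.5) of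
`(1-w)^{-2}(ξ'/ξ)(1/(1-w)) = ∑ ∫₀^∞ 4^{-1}e^{-t/2}Ψ(t)P_n(t)dt · wⁿ`, `z = (i/2)(1+w)/(1-w)` in
(1.2), with `P_n` computed explicitly.) [cite: Suzuki2023, Thm 8.1 (8.1)–(8.2), p. 18 (arXiv p0018:L8–24)] -/
def Suzuki2023_thm81 : Prop :=
  ∀ n : ℕ, 1 ≤ n → keiperLiCoeff n / (n ! : ℝ) = suzukiLiOfMoments zetaScrewMoment n

/-- The cases `n = 1, 2, 3` of (8.2) are (8.1): for ANY sequence `μ`, the right-hand side of (8.2)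
equals `μ₀`, `(6μ₀ - μ₁)/2!`, `(19μ₀ - 7μ₁ + μ₂/2)/3!` respectively (pure arithmetic).
[cite: Suzuki2023, (8.1), p. 18 (arXiv p0018:L10–14)] -/
theorem Suzuki2023_thm81_cases (μ : ℕ → ℝ) :
    suzukiLiOfMoments μ 1 = μ 0 ∧
      suzukiLiOfMoments μ 2 = (6 * μ 0 - μ 1) / (2 ! : ℝ) ∧
        suzukiLiOfMoments μ 3 = (19 * μ 0 - 7 * μ 1 + μ 2 / 2) / (3 ! : ℝ) := by
  simp only [suzukiLiOfMoments, Finset.sum_range_succ, Finset.sum_range_zero, Nat.factorial,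
    Nat.succ_eq_add_one]
  push_cast
  refine ⟨?_, ?_, ?_⟩ <;> ring

/-- RH-FREE. **Suzuki2023 Thm 8.1, (8.3)** (the inverse relation): "Conversely, the moments are
represented by the Li coefficients as
`(1/n!) μ_n = ∑_{j=1}^{n+1} [∑_{k=1}^{n-j+2} k 2^{k-1} binom(n-k+2, j)] (-1)^{j+1} λ_j`
for all non-negative integers `n`. The relations (8.1)–(8.2) and (8.3) are inverse to each other."
(Proof §8: the substitution `w = X/(X-1)` turns (8.4) into
`(1-2X)^{-2}(1-X)^{-2}∑λ_{n+1}(X/(X-1))ⁿ = ∑ μ_n Xⁿ/n!` (8.6), expanded with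
`λ_n = ∑_ρ(1-(1-ρ^{-1})ⁿ)` [Li97].) The `ℕ`-subtractions `n + 2 - j`, `n + 2 - k` are genuine
(`j ≤ n+1`, `k ≤ n+2-j`). [cite: Suzuki2023, Thm 8.1 (8.3), p. 18 (arXiv p0018:L25–35)] -/
def Suzuki2023_thm81_inv : Prop :=
  ∀ n : ℕ, zetaScrewMoment n / (n ! : ℝ) =
    ∑ j ∈ Finset.Icc 1 (n + 1),
      (∑ k ∈ Finset.Icc 1 (n + 2 - j), (k : ℝ) * 2 ^ (k - 1) * ((n + 2 - k).choose j : ℝ)) *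
        (-1) ^ (j + 1) * keiperLiCoeff j

/-! ## Thm 8.2: the recurrence for the moments -/

/-- Li's Taylor coefficients `a_j` of the NORMALISED `ξ`: "Let `{a_j}_{j≥1}` be coefficients of the
power series expansion `ξ(1/(1-w)) = 1 + ∑_{j≥1} a_j w^j`" (Suzuki2023 Thm 8.2, after [Li97]).
The constant term `1` presupposes Li's normalisation `ξ_Li(1) = 1`, i.e. `ξ_Li = 2ξ` for the
`ξ(s) = ½s(s-1)π^{-s/2}Γ(s/2)ζ(s)` of Suzuki2023 p. 2 and of the tree (`riemannXi_one`:
`ξ(1) = 1/2`); the recurrence (8.10) `λ_{n+1} = (n+1)a_{n+1} - ∑_{j=1}^{n} a_{n-j+1}λ_j` quoted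
from [Li97] in the proof holds exactly for the coefficients of `ξ(1/(1-w))/ξ(1) = 2φ(w)`, `φ = liPhi`,
which is therefore what `a_j` denotes: `a_j = 2 φ^{(j)}(0)/j!` (real: `φ` has real Taylor
coefficients; positive by [Li97], cf. the tree's `iteratedDeriv_liPhi_zero_nonneg`). `a_0 = 1`
(`liXiCoeff_zero`). [cite: Suzuki2023, Thm 8.2 (definition of `a_j`), p. 19 (arXiv p0019:L7–10); Li1997, (2.3)] -/
def liXiCoeff (j : ℕ) : ℝ :=
  (2 * iteratedDeriv j liPhi 0 / (j ! : ℂ)).re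

/-- `a_0 = 2φ(0) = 2ξ(1) = 1`. [cite: Suzuki2023, Thm 8.2] -/
theorem liXiCoeff_zero : liXiCoeff 0 = 1 := by
  simp [liXiCoeff, liPhi_zero]

/-- Suzuki's coefficients `b_{n,k}` (`n ∈ ℤ_{>0}`, `0 ≤ k ≤ n`) of Thm 8.2:
`b_{n,k} := n!/(k!(k+3)!) · [ (n+1)!/(n-k)! · ((k - (4n+3)/2)² + 2n + 15/4)
  + ∑_{j=k+1}^{n} j!/(j-k-1)! · ((2j-k)² + k + 2) · a_{n-j+1} ]`
with `a_j = liXiCoeff j`. (For `k ≤ n` all `ℕ`-subtractions are genuine: `n - k`, `j - k - 1`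
for `j ≥ k+1`, `n - j + 1` for `j ≤ n`, written `n + 1 - j`.)
[cite: Suzuki2023, Thm 8.2 (definition of `b_{n,k}`), p. 19 (arXiv p0019:L10–24)] -/
def suzukiB (n k : ℕ) : ℝ :=
  (n ! : ℝ) / ((k ! : ℝ) * ((k + 3)! : ℝ)) *
    (((n + 1)! : ℝ) / ((n - k)! : ℝ) * (((k : ℝ) - (4 * n + 3) / 2) ^ 2 + 2 * n + 15 / 4) +
      ∑ j ∈ Finset.Icc (k + 1) n,
        (j ! : ℝ) / ((j - k - 1)! : ℝ) * ((2 * (j : ℝ) - k) ^ 2 + k + 2) * liXiCoeff (n + 1 - j))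

/-- RH-FREE. **Suzuki2023 Thm 8.2**: with `a_j` (`liXiCoeff`) and `b_{n,k}` (`suzukiB`) as
above, "all `b_{n,k}` are positive and the recurrence relation
`(-1)ⁿ μ_n = (n+1)! a_{n+1} - ∑_{k=0}^{n-1} (-1)^k b_{n,k} μ_k` (8.9) holds for all non-negative
`n`." (Proof: positivity from `a_j > 0` [Li97]; the recurrence by substituting (8.1)–(8.2) into
Li's recurrence (8.10) `λ_{n+1} = (n+1)a_{n+1} - ∑_{j=1}^{n} a_{n-j+1}λ_j` and regrouping.)
The positivity clause is stated on the printed range `n ≥ 1`, `k ≤ n`.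
[cite: Suzuki2023, Thm 8.2 and (8.9), p. 19 (arXiv p0019:L7–30)] -/
def Suzuki2023_thm82 : Prop :=
  (∀ n k : ℕ, 1 ≤ n → k ≤ n → 0 < suzukiB n k) ∧
    ∀ n : ℕ, (-1) ^ n * zetaScrewMoment n =
      ((n + 1)! : ℝ) * liXiCoeff (n + 1) -
        ∑ k ∈ Finset.range n, (-1) ^ k * suzukiB n k * zetaScrewMoment k

/-! ## §11: the shifted variants `Ψ_ω` and Thm 11.1 -/

/-- The **shifted screw function** `Ψ_ω` of Suzuki2023 (11.1): for real `ω` and `t > 0`,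
`Ψ_ω(t) := e^{-ωt}Ψ(t) + 2ω∫₀ᵗ e^{-ωu}Ψ(u) du + ω²∫₀ᵗ (t-u)e^{-ωu}Ψ(u) du`, "and extend it as an
even function on `ℝ`" (so `t` is replaced by `|t|`; at `t = 0` the formula gives `Ψ_ω(0) = 0`,
as stated on p. 22). `Ψ_0 = Ψ` (`zetaScrewShift_zero_left`). One has (11.2), the Laplace formula
`Suzuki2023_eq112`, and the explicit prime/zero expansions of p. 22 (not typed).
[cite: Suzuki2023, (11.1), p. 22 (arXiv p0022:L3–12)] -/
def zetaScrewShift (ω t : ℝ) : ℝ :=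
  Real.exp (-(ω * |t|)) * zetaScrew |t| +
    2 * ω * (∫ u in (0 : ℝ)..|t|, Real.exp (-(ω * u)) * zetaScrew u) +
      ω ^ 2 * (∫ u in (0 : ℝ)..|t|, (|t| - u) * Real.exp (-(ω * u)) * zetaScrew u)

/-- `Ψ_ω` is even (by construction). [cite: Suzuki2023, (11.1)] -/
theorem zetaScrewShift_neg (ω t : ℝ) : zetaScrewShift ω (-t) = zetaScrewShift ω t := by
  simp [zetaScrewShift, abs_neg]

/-- `Ψ_ω(0) = 0`. [cite: Suzuki2023, §11, p. 22 ("We have `Ψ_ω(0) = 0` as well as `Ψ(t)`")] -/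
theorem zetaScrewShift_zero_right (ω : ℝ) : zetaScrewShift ω 0 = 0 := by
  simp [zetaScrewShift, zetaScrew_zero]

/-- `Ψ_0 = Ψ` ("Then we have `Ψ_0(t) = Ψ(t)`", p. 22). [cite: Suzuki2023, §11, p. 22 (arXiv p0022:L13)] -/
theorem zetaScrewShift_zero_left (t : ℝ) : zetaScrewShift 0 t = zetaScrew t := by
  have h : zetaScrew |t| = zetaScrew t := by
    rcases le_or_gt 0 t with ht | ht
    · rw [abs_of_nonneg ht]
    · rw [abs_of_neg ht, zetaScrew_neg]
  simp [zetaScrewShift, h]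

/-- RH-FREE. **Suzuki2023 (11.2)**: for real `ω`,
`∫₀^∞ Ψ_ω(t) e^{izt} dt = -z^{-2}(ξ'/ξ)(1/2 + ω - iz)`, "by (1.2) and a little calculation"
(indeed the three terms of (11.1) have transforms `F(z+iω)`, `2ω(i/z)F(z+iω)`,
`ω²(-1/z²)F(z+iω)` with `F(z) = ∫₀^∞Ψe^{izt} = -z^{-2}(ξ'/ξ)(1/2-iz)`, and
`(1 + iω/z)² (z+iω)^{-2} = z^{-2}`). HALF-PLANE: printed "`Im(z) > 1/2 - ω`"; the first term needs
exactly `Im z > 1/2 - ω` (Thm 1.1 (1) at `z + iω`), while the two convolution terms grow linearly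
in `t` when `ω ≠ 0` (e.g. `Ψ_{1/2}(t) ∼ λ₁ t`) and their transforms need `Im z > 0`; so the
identity, with absolute convergence of the left side, is typed on `Im z > max(1/2 - ω, 0)` —
equal to the printed half-plane for `ω ≤ 1/2`, and the part of it on which the left side
converges for `ω > 1/2` (scope made precise, statement not weakened where it is meaningful).
`(ξ'/ξ)` is written `deriv ξ / ξ` as in `Suzuki2023_thm11_fourier`.
[cite: Suzuki2023, (11.2), p. 22 (arXiv p0022:L13–20)] -/
def Suzuki2023_eq112 : Prop :=
  ∀ ω : ℝ, ∀ z : ℂ, max (1 / 2 - ω) 0 < z.im →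
    IntegrableOn (fun t : ℝ ↦ (zetaScrewShift ω t : ℂ) * cexp (I * z * t)) (Ioi 0) ∧
      ∫ t in Ioi (0 : ℝ), (zetaScrewShift ω t : ℂ) * cexp (I * z * t) =
        -(1 / z ^ 2) *
          (deriv riemannXi (1 / 2 + ω - I * z) / riemannXi (1 / 2 + ω - I * z))

/-- RH-EQUIVALENT at `ω = 0` (line 1: there it reads "RH ⟺ `Ψ(t) ≥ 0` for all large `t`", a
sharpening of the `⟸` half of Thm 1.7 = `Suzuki2023_thm17`); for general `ω` a GRADED family:
the left side is the quasi-Riemann hypothesis "no zeros of `ξ` with `Re s > 1/2 + ω`" (for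
`1/2 + ω < 1` the tree's `QuasiRiemannHypothesis (1/2 + ω)` up to the dictionary
`riemannXi_eq_zero_iff`), OPEN for `0 ≤ ω < 1/2`, a THEOREM for `ω ≥ 1/2`
(`riemannXi_ne_zero_of_one_le_re`), FALSE for `ω < 0` (there are zeros on the critical line).
**Suzuki2023 Thm 11.1**: "Let `ω ∈ ℝ`. Then `ξ(s) ≠ 0` for `Re(s) > 1/2 + ω` if and only if there
exists `t₀ > 0` such that `Ψ_ω(t)` is non-negative when `t ≥ t₀`." (Proof sketch p. 22: `⟹` by
(11.2), the expansion `Im[i(ξ'/ξ)(s+ω)] = ∑_ρ (Re(s+ω) - Re ρ)/|s+ω-ρ|²` showing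
`i(ξ'/ξ)(1/2+ω-iz) ∈ 𝒩`, and [KrLa77]; `⟸` by (11.2), `ξ ≠ 0` on the positive real line and the
Laplace-transform argument of the proof of Thm 1.7.) Neither direction is in the tree for general
`ω`; see `Suzuki2023_thm111.eventually_nonneg` for the unconditional consequence at `ω ≥ 1/2`
noted on p. 22 ("`Ψ_ω(t) ≥ 0` unconditionally if `ω ≥ 1/2`").
[cite: Suzuki2023, Thm 11.1, p. 22 (arXiv p0022:L48–52)] -/
def Suzuki2023_thm111 : Prop :=
  ∀ ω : ℝ, (∀ s : ℂ, 1 / 2 + ω < s.re → riemannXi s ≠ 0) ↔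
    ∃ t₀ : ℝ, 0 < t₀ ∧ ∀ t : ℝ, t₀ ≤ t → 0 ≤ zetaScrewShift ω t

/-- The unconditional rung of the family: granted Thm 11.1, for `ω ≥ 1/2` the function `Ψ_ω` is
eventually non-negative, because `ξ(s) ≠ 0` for `Re s ≥ 1` (tree:
`riemannXi_ne_zero_of_one_le_re`) — "The above result shows that `Ψ_ω(t) ≥ 0` unconditionally if
`ω ≥ 1/2`, because it is well-known that `ξ(s) ≠ 0` for `Re(s) > 1`" (p. 22). RH-FREE modulo the
named fact. [cite: Suzuki2023, §11, p. 22 (arXiv p0022:L54–56)] -/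
theorem Suzuki2023_thm111.eventually_nonneg (h : Suzuki2023_thm111) {ω : ℝ} (hω : 1 / 2 ≤ ω) :
    ∃ t₀ : ℝ, 0 < t₀ ∧ ∀ t : ℝ, t₀ ≤ t → 0 ≤ zetaScrewShift ω t :=
  (h ω).1 fun s hs ↦ riemannXi_ne_zero_of_one_le_re (by linarith)

/-! ## §4: Yoshida's spaces, the transform `Φ₁`, and Thm 4.3 -/

/-- Yoshida's space `K(a)` (`0 < a < ∞`; Suzuki2023 §4.2 after [Yo92]):
`K(a) := {ψ : ψ(t) = h(t) for |t| ≤ a, for some h ∈ C^∞(ℝ) with the period 2a; ψ(t) = 0 for |t| > a}`,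
functions `ℝ → ℂ` (smooth = `ContDiff ℝ ∞`, written `ContDiff ℝ (⊤ : ℕ∞)`, the exponent of the
tree's `IsWeilTest`; period via
`Function.Periodic`). [cite: Suzuki2023, §4.2 (definition of `K(a)`), p. 8 (arXiv p0008:L44–56); Yoshida1992] -/
def yoshidaK (a : ℝ) : Set (ℝ → ℂ) :=
  {ψ | (∃ h : ℝ → ℂ, ContDiff ℝ (⊤ : ℕ∞) h ∧ Function.Periodic h (2 * a) ∧
      ∀ t : ℝ, |t| ≤ a → ψ t = h t) ∧
    ∀ t : ℝ, a < |t| → ψ t = 0}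

/-- Yoshida's space `K_N(a)` (Suzuki2023 (4.1)):
`K_N(a) := {ψ ∈ K(a) : ∫_{-a}^{a} ψ(x) exp(πinx/a) dx = 0 for all n ∈ ℤ, |n| ≤ N}` (the first
`2N+1` Fourier coefficients of period `2a` vanish; the integral over `[-a,a]` is written over the
null-different window `Ioo (-a) a`). [cite: Suzuki2023, (4.1), p. 8 (arXiv p0008:L58–62); Yoshida1992] -/
def yoshidaKN (a : ℝ) (N : ℕ) : Set (ℝ → ℂ) :=
  {ψ | ψ ∈ yoshidaK a ∧ ∀ n : ℤ, |n| ≤ (N : ℤ) →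
    ∫ x in Ioo (-a) a, ψ x * cexp (Real.pi * I * (n : ℂ) * (x : ℂ) / (a : ℂ)) = 0}

/-- `K_N(a) ⊆ K(a)`. [cite: Suzuki2023, (4.1), p. 8] -/
theorem yoshidaKN_subset_yoshidaK (a : ℝ) (N : ℕ) : yoshidaKN a N ⊆ yoshidaK a :=
  fun _ h ↦ h.1

/-- `K_N(a)` decreases in `N`. [cite: Suzuki2023, (4.1), p. 8] -/
theorem yoshidaKN_antitone (a : ℝ) {M N : ℕ} (h : M ≤ N) : yoshidaKN a N ⊆ yoshidaKN a M :=
  fun _ hψ ↦ ⟨hψ.1, fun n hn ↦ hψ.2 n (hn.trans (by exact_mod_cast h))⟩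

/-- The transform `Φ₁` of Suzuki2023 (4.2): for `φ ∈ L²(-a,a)` (a function vanishing off the
window), `Φ₁(φ,z) := (φ̂(z) - φ̂(0))/z = ∫_{-a}^{a} φ(t) (e^{izt} - 1)/z dt`, with
`φ̂(z) = ∫ φ(t)e^{izt}dt` (§3, p. 7). Typed for complex `z` as the window integral; at `z = 0` the
Lean value is the junk `0` (division by zero) where the source means the removable value
`i∫ tφ(t) dt` — immaterial below, where only `∫_ℝ |Φ₁(φ,z)|² dz` occurs.
[cite: Suzuki2023, (4.2), p. 8 (arXiv p0008:L116–120)] -/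
def screwPhi1 (a : ℝ) (f : ℝ → ℂ) (z : ℂ) : ℂ :=
  ∫ t in Ioo (-a) a, f t * ((cexp (I * z * t) - 1) / z)

/-- The space `𝔎_{N,0}(a)` of Suzuki2023 §4.4 (before Thm 4.3):
`𝔎_{N,0}(a) := {φ ∈ L²(-a,a) : φ̂(0) = 0, I_0^{(a)}(φ) ∈ K_N(a)}`, with `I_0^{(a)}φ(t) = ∫_{-a}^{t}φ`
(`screwPrimitive a 0 φ` of `ZetaScrewHermitianForms.lean`) and `φ̂(0) = ∫_{-a}^{a} φ`. An element
of `L²(-a,a)` is typed, as in the source's usage (`φ̂`, `⟨φ,φ⟩_{G_g,a}` "for functions supported in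
`[-a,a]`"), as a function `ℝ → ℂ` vanishing off the window and square-integrable on it; for an
`Lp ℂ 2 (volume.restrict (Ioo (-a) a))` class apply this to `(Ioo (-a) a).indicator φ`.
[cite: Suzuki2023, §4.4 (definition of `𝔎_{N,0}(a)`), p. 10 (arXiv p0010:L86–94)] -/
def screwKN0 (a : ℝ) (N : ℕ) : Set (ℝ → ℂ) :=
  {f | MemLp f 2 (volume.restrict (Ioo (-a) a)) ∧ (∀ t : ℝ, t ∉ Ioo (-a) a → f t = 0) ∧
    ∫ t in Ioo (-a) a, f t = 0 ∧ screwPrimitive a 0 f ∈ yoshidaKN a N}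

/-- RH-FREE (a Yoshida-type lower bound, used in §5 to prove Thm 1.4; not in the tree).
**Suzuki2023 Thm 4.3**: "Let `a₀ > 0` and `μ > 0` be given numbers. Then there exists `N ≥ 0` such
that `⟨φ,φ⟩_{G_g,a} ≥ μ ∫_{-∞}^{∞} |Φ₁(φ,z)|² dz` (4.13) for every `φ ∈ 𝔎_{N,0}(a)` and
`0 < a ≤ a₀`, where `Φ₁(φ,z)` is the transform of `φ` in (4.2)." The form is
`zetaScrewForm (Ioo (-a) a) φ φ` ((1.10), `ZetaScrewHermitianForms.lean`); the inequality between
the real number `μ∫|Φ₁|²` and the (real, for this hermitian kernel) value of the form is typed in the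
order of `ℂ`, as the non-negativity statements of that module. (Proof §4.4: the lower bound (4.11)
from the proof of Thm 4.2 with `C > 3C₁C₂ + μ`, plus the Yoshida-type estimate
`∫_{|z|≤t₀}|Φ₁|² ≪ N^{-1/2}∫|Φ₁|²` on `𝔎_{N,0}(a)`.) [cite: Suzuki2023, Thm 4.3, p. 10 (arXiv p0010:L97–106)] -/
def Suzuki2023_thm43 : Prop :=
  ∀ a₀ : ℝ, 0 < a₀ → ∀ μ : ℝ, 0 < μ → ∃ N : ℕ, ∀ a : ℝ, 0 < a → a ≤ a₀ →
    ∀ f ∈ screwKN0 a N,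
      (((μ * ∫ z : ℝ, ‖screwPhi1 a f z‖ ^ 2 : ℝ) : ℂ)) ≤ zetaScrewForm (Ioo (-a) a) f f

end Literature.NumberTheory.LFunctions

end
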